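import Literature.NumberTheory.EllipticCurves.CasselsTateLevelAssembly
import HarnessLib

/-!
# A level pairing on `Ш(E/K)[m]` pulled back to the Selmer group at level `m²`, when `Ш[m²] = Ш[m]`

Topic `NumberTheory/EllipticCurves`; namespace `Literature.NumberTheory.EllipticCurves`. Theorems only:
**no definition and no named fact is introduced** (D-0026). Companion of `CasselsTateLevelAssembly`
(the level-`m` Cassels–Tate pairing `ctLevelPairing` on `Ш(E/K)[m]`, Milne *ADT* I §6).

Kolyvagin's descent (McCallum 1991, §5) is written on `V = H¹(K, E[p^M])` and its Selmer group
`Sel = S_{p^M}(E/K)`, while the Cassels–Tate pairing lives on `Ш(E/K)[m]`. When `p^{M₀}` kills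
`Ш(E/K)[p^∞]` (Kolyvagin's annihilation) and `M = 2M₀`, `m = p^{M₀}`, every class of `Ш[m²]` is killed
by `m`, and the level-`m` pairing pulls back to `Sel^{(m²)}(E/K)` along
`Sel^{(m²)} → Ш[m²] = Ш[m]`. This file records that bookkeeping for an ARBITRARY bi-additive
`B : Ш[m] × Ш[m] → R` under the hypothesis `hL : Ш[m²] ⊆ Ш[m]`:

* `exists_selmerToShaTorsion`: the map `ι : Sel^{(m²)}(E/K) →+ Ш(E/K)[m]`, `z ↦` (image of `z` in
  `H¹(K, E)`), granted `hL`;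
* `pullback_eq_zero_of_torsionH1ToH1_eq_zero` (`_right`): `B(ι z, ι t) = 0` if `z` (or `t`) dies in
  `H¹(K, E)`, i.e. comes from `E(K)/m²E(K)` — in particular for Kolyvagin's class `x = δ x₀`;
* `torsionH1ToH1_eq_zero_of_forall_pullback_eq_zero`: if `B` has the Cassels–Tate kernel property
  at level `m` (`IsLevelPairing`: kernel `Ш[m] ∩ mШ`) then the left kernel of the pulled-back pairing
  on `Sel^{(m²)}` is contained in — hence equal to — the kernel of `Sel^{(m²)} → H¹(K, E)` (every class
  of `Ш[m]` has a Selmer lift at level `m²`, and `mШ ∩ Ш[m] ∋ m a₀` forces `m² a₀ = 0`, so `m a₀ = 0`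
  by `hL`): the "non-degenerate modulo `E(K)/m²`" input of the descent;
* `pullback_self_eq_zero`: alternation transfers;
* `ctLevelPairing_pullback_apply`: for `B = ctLevelPairing` the pulled-back value at `(z, t)` is
  `ctGeneralFun` of the images of `z, t` in `H¹(K, E)`, embedded by `ℤ/m² ↪ ℚ/ℤ`.

## References

* [MilneADT2006] J. S. Milne, *Arithmetic Duality Theorems*, 2nd ed. (2006), Ch. I §6, Prop. 6.9,
  Thm. 6.13(a).
* [McCallumLMS1991] W. G. McCallum, *Kolyvagin's work on Shafarevich–Tate groups*, LMS Lecture Note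
  Ser. 153 (1991), §5 (proof of Thm. 5.4: the pairing on `Ш(E/K)_{p^M}`).
-/

noncomputable section

open scoped Classical
open scoped AddSubgroup

universe u

namespace Literature.NumberTheory.EllipticCurves

open CategoryTheory _root_.WeierstrassCurve Field Function NumberField
open Literature.NumberTheory.GaloisRepresentations Literature.NumberTheory.GaloisCohomology
open Literature.NumberTheory.GaloisRepresentations.DiscreteGaloisModule (mu MuCarrier pairing)
open Literature.GroupTheory.FiniteAbelian
open scoped ContRepresentation

-- Cup products need `LocallyCompactSpace Γ`; as in the tree's cup-product files, the compactness of
-- absolute Galois groups is a local instance only.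
attribute [local instance] absoluteGaloisGroup_compactSpace

-- `char K_v = 0` for the completions of a number field (local instance, no override).
attribute [local instance] charZero_placeCompletion

section Pullback

variable {K : Type u} [Field K] [NumberField K] (W : WeierstrassCurve K) (m : ℕ) [NeZero m]

/-- **The map `Sel^{(m²)}(E/K) → Ш(E/K)[m]`** when every class of `Ш(E/K)` killed by `m²` is killed
by `m` (`hL`; e.g. `m = p^{M₀}` with `p^{M₀} Ш(E/K)[p^∞] = 0`): `z ↦` the image of `z` in `H¹(K, E)`
(a class of `Ш`, `torsionH1ToH1_mem_sha_of_mem_selmerGroup`, killed by `m²`,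
`torsionH1ToH1_mem_torsionBy`, hence by `m`). [cite: MilneADT2006, Ch. I §6, (6.14) and Prop. 6.9] -/
theorem exists_selmerToShaTorsion
    (hL : ∀ a ∈ W.sha, (((m * m : ℕ) : ℤ)) • a = 0 → (m : ℤ) • a = 0) :
    ∃ ι : selmerGroup W ((m * m : ℕ) : ℤ) →+ (W.sha)[m],
      ∀ z, shaTorsionVal W m (ι z) = torsionH1ToH1 W ((m * m : ℕ) : ℤ) z := by
  have hn : ((m * m : ℕ) : ℤ) ≠ 0 := Int.natCast_ne_zero.mpr (NeZero.ne (m * m))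
  have hmem : ∀ z : selmerGroup W ((m * m : ℕ) : ℤ),
      torsionH1ToH1 W ((m * m : ℕ) : ℤ) z ∈ W.sha := fun z =>
    torsionH1ToH1_mem_sha_of_mem_selmerGroup (W := W) hn z.2
  have htor : ∀ z : selmerGroup W ((m * m : ℕ) : ℤ),
      (⟨torsionH1ToH1 W ((m * m : ℕ) : ℤ) z, hmem z⟩ : W.sha) ∈ (W.sha)[m] := fun z =>
    mem_torsionBy_sha_of_zsmul_eq_zero W m (hmem z)
      (hL _ (hmem z) (torsionH1ToH1_mem_torsionBy W ((m * m : ℕ) : ℤ) z))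
  refine ⟨AddMonoidHom.mk' (fun z => ⟨⟨torsionH1ToH1 W ((m * m : ℕ) : ℤ) z, hmem z⟩, htor z⟩)
    (fun z₁ z₂ => Subtype.ext (Subtype.ext ?_)), fun z => rfl⟩
  change torsionH1ToH1 W ((m * m : ℕ) : ℤ) ((z₁ + z₂ : selmerGroup W ((m * m : ℕ) : ℤ)) :
      galH1Torsion W ((m * m : ℕ) : ℤ)) =
    torsionH1ToH1 W ((m * m : ℕ) : ℤ) z₁ + torsionH1ToH1 W ((m * m : ℕ) : ℤ) z₂
  rw [AddSubgroup.coe_add, map_add]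

variable {W m}
variable {R : Type*} [AddCommGroup R] (B : (W.sha)[m] →+ (W.sha)[m] →+ R)
variable (ι : selmerGroup W ((m * m : ℕ) : ℤ) →+ (W.sha)[m])
  (hι : ∀ z, shaTorsionVal W m (ι z) = torsionH1ToH1 W ((m * m : ℕ) : ℤ) z)

omit [NeZero m] in
include hι in
/-- `ι z = 0` iff `z` dies in `H¹(K, E)` (i.e. `z ∈ E(K)/m²E(K)` by the Kummer sequence).
[cite: SilvermanAEC2009, X.§4] -/
theorem selmerToShaTorsion_eq_zero_iff (z : selmerGroup W ((m * m : ℕ) : ℤ)) :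
    ι z = 0 ↔ torsionH1ToH1 W ((m * m : ℕ) : ℤ) z = 0 := by
  rw [← hι z]
  constructor
  · intro h
    rw [h]
    rfl
  · intro h
    exact Subtype.ext (Subtype.ext h)

omit [NeZero m] in
include hι in
/-- **The pulled-back pairing vanishes on the classes dying in `H¹(K, E)`** (left argument): in
Kolyvagin's descent, `P(x, ·) = 0` for `x = δ_M x₀ ∈ E(K)/p^M E(K)`.
[cite: McCallumLMS1991, §5 Thm. 5.4 (proof)] -/
theorem pullback_eq_zero_of_torsionH1ToH1_eq_zero {z : selmerGroup W ((m * m : ℕ) : ℤ)}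
    (hz : torsionH1ToH1 W ((m * m : ℕ) : ℤ) z = 0) (t : selmerGroup W ((m * m : ℕ) : ℤ)) :
    B (ι z) (ι t) = 0 := by
  rw [(selmerToShaTorsion_eq_zero_iff ι hι z).mpr hz, map_zero, AddMonoidHom.zero_apply]

omit [NeZero m] in
include hι in
/-- The pulled-back pairing vanishes on the classes dying in `H¹(K, E)` (right argument).
[cite: McCallumLMS1991, §5 Thm. 5.4 (proof)] -/
theorem pullback_eq_zero_of_torsionH1ToH1_eq_zero_right (z : selmerGroup W ((m * m : ℕ) : ℤ))
    {t : selmerGroup W ((m * m : ℕ) : ℤ)} (ht : torsionH1ToH1 W ((m * m : ℕ) : ℤ) t = 0) :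
    B (ι z) (ι t) = 0 := by
  rw [(selmerToShaTorsion_eq_zero_iff ι hι t).mpr ht, map_zero]

omit [NeZero m] in
/-- Alternation transfers to the pulled-back pairing. [cite: MilneADT2006, Ch. I §6, Rem. 6.11] -/
theorem pullback_self_eq_zero (halt : ∀ x, B x x = 0) (z : selmerGroup W ((m * m : ℕ) : ℤ)) :
    B (ι z) (ι z) = 0 :=
  halt (ι z)

include hι in
/-- **Every class of `Ш(E/K)[m]` is `ι` of a Selmer class at level `m²`** (Kummer sequence at level
`m²`: `exists_selmer_lift`). [cite: SilvermanAEC2009, Thm X.4.2(a)] -/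
theorem selmerToShaTorsion_surjective [W.IsElliptic] : Surjective ι := by
  intro y
  have hy : (((m * m : ℕ) : ℤ)) • shaTorsionVal W m y = 0 := by
    rw [Nat.cast_mul, mul_zsmul, zsmul_shaTorsionVal, zsmul_zero]
  obtain ⟨t, ht, hty⟩ := exists_selmer_lift (W := W) (m := m * m) (shaTorsionVal_mem W m y) hy
  refine ⟨⟨t, ht⟩, Subtype.ext (Subtype.ext ?_)⟩
  change shaTorsionVal W m (ι ⟨t, ht⟩) = shaTorsionVal W m y
  rw [hι]
  exact hty

include hι in
/-- **The kernel of the pulled-back pairing is the kernel of `Sel^{(m²)} → H¹(K, E)`** when `B` has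
the Cassels–Tate kernel property at level `m` (`IsLevelPairing m B`: `B(x, ·) = 0 ↔ x ∈ mШ`, Milne I
Thm. 6.13(a)) and `Ш[m²] ⊆ Ш[m]` (`hL`): if `B(ι z, ι t) = 0` for all `t ∈ Sel^{(m²)}` then the image
`a` of `z` in `Ш` is `m a₀` with `m² a₀ = m a = 0`, so `a = m a₀ = 0`. This is the input
"`P(z, ·) = 0 ⟹ z ∈ E(K)/p^M`" of Kolyvagin's descent on `Ш(E/K)_{p^M} = Sel/(E(K)/p^M)`.
[cite: MilneADT2006, Ch. I §6, Thm. 6.13(a)] [cite: McCallumLMS1991, §5 Thm. 5.4 (proof)] -/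
theorem torsionH1ToH1_eq_zero_of_forall_pullback_eq_zero [W.IsElliptic] (hB : IsLevelPairing m B)
    (hL : ∀ a ∈ W.sha, (((m * m : ℕ) : ℤ)) • a = 0 → (m : ℤ) • a = 0)
    {z : selmerGroup W ((m * m : ℕ) : ℤ)} (hz : ∀ t : selmerGroup W ((m * m : ℕ) : ℤ), B (ι z) (ι t) = 0) :
    torsionH1ToH1 W ((m * m : ℕ) : ℤ) z = 0 := by
  have hall : ∀ y : (W.sha)[m], B (ι z) y = 0 := fun y => by
    obtain ⟨t, rfl⟩ := selmerToShaTorsion_surjective ι hι y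
    exact hz t
  obtain ⟨a₀, ha₀⟩ := (hB.2 (ι z)).mp hall
  -- `m² a₀ = m (ι z) = 0`, hence `m a₀ = 0` by `hL`, i.e. `ι z = 0`
  have h1 : (m : ℤ) • (a₀ : W.galH1) = (((ι z : (W.sha)[m]) : W.sha) : W.galH1) := by
    rw [natCast_zsmul, ← AddSubgroupClass.coe_nsmul, ha₀]
  have hm2 : (((m * m : ℕ) : ℤ)) • (a₀ : W.galH1) = 0 := by
    rw [Nat.cast_mul, mul_zsmul, h1]
    exact zsmul_shaTorsionVal W m (ι z)
  have hma₀ : (m : ℤ) • (a₀ : W.galH1) = 0 := hL _ a₀.2 hm2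
  rw [← hι z]
  change ((((ι z : (W.sha)[m]) : W.sha)) : W.galH1) = 0
  rw [← ha₀, AddSubgroupClass.coe_nsmul, ← natCast_zsmul]
  exact hma₀

include hι in
/-- The converse: the pulled-back pairing of a level pairing is "non-degenerate modulo the classes
dying in `H¹(K, E)`", as an iff. [cite: MilneADT2006, Ch. I §6, Thm. 6.13(a)] -/
theorem forall_pullback_eq_zero_iff [W.IsElliptic] (hB : IsLevelPairing m B)
    (hL : ∀ a ∈ W.sha, (((m * m : ℕ) : ℤ)) • a = 0 → (m : ℤ) • a = 0)
    (z : selmerGroup W ((m * m : ℕ) : ℤ)) :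
    (∀ t : selmerGroup W ((m * m : ℕ) : ℤ), B (ι z) (ι t) = 0) ↔
      torsionH1ToH1 W ((m * m : ℕ) : ℤ) z = 0 :=
  ⟨torsionH1ToH1_eq_zero_of_forall_pullback_eq_zero B ι hι hB hL,
    fun hz t => pullback_eq_zero_of_torsionH1ToH1_eq_zero B ι hι hz t⟩

end Pullback

/-! ## The level-`m` Cassels–Tate pairing pulled back -/

section Level

variable {K : Type u} [Field K] [NumberField K] {W : WeierstrassCurve K} {m : ℕ} [NeZero m]
variable (e : geomTorsion W ((m * m : ℕ) : ℤ) → geomTorsion W ((m * m : ℕ) : ℤ) → AlgebraicClosure K)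
  (hμ : ∀ S T, e S T ^ (m * m) = 1)
  (hadd₁ : ∀ S₁ S₂ T, e (S₁ + S₂) T = e S₁ T * e S₂ T)
  (hadd₂ : ∀ S T₁ T₂, e S (T₁ + T₂) = e S T₁ * e S T₂)
  (hgal : ∀ (σ : absoluteGaloisGroup K) (S T : geomTorsion W ((m * m : ℕ) : ℤ)),
    σ • e S T = e (σ • S) (σ • T))
variable (inv : LocalInvariants K (m * m))
variable (halt : ∀ T, e T T = 1) (hPT' : inv.SumInvLocalizationEqZero)
  (hH3 : ∀ c : galoisCohomology (mu K (m * m)) 3,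
    (∀ v : Place K, galoisCohomology.localization (mu K (m * m)) v 3 c = 0) → c = 0)
  (hfin : ∀ D : GeneralCaseData W m e hμ hadd₁ hadd₂ hgal, ∃ S : Finset (Place K), ∀ v ∉ S, D.localTerm inv v = 0)
variable (ι : selmerGroup W ((m * m : ℕ) : ℤ) →+ (W.sha)[m])
  (hι : ∀ z, shaTorsionVal W m (ι z) = torsionH1ToH1 W ((m * m : ℕ) : ℤ) z)

include hι in
/-- **The value of the pulled-back Cassels–Tate pairing**: for `B = ctLevelPairing` (level `m`,
auxiliary level `m²`), `B(ι z, ι t)` is `ctGeneralFun` of the images of `z, t` in `H¹(K, E)`, through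
`ℤ/m² ↪ ℚ/ℤ` (`ctLevelPairing_apply`). With `CasselsTateSelmerFirstCase` this is, for `z = m • b₁`
and `t` supported at one place `v₀` in the sense there, `zmodToCircle (m²)` of a single local term.
[cite: MilneADT2006, Ch. I §6, Prop. 6.9] -/
theorem ctLevelPairing_pullback_apply [W.IsElliptic] (z t : selmerGroup W ((m * m : ℕ) : ℤ)) :
    ctLevelPairing W m e hμ hadd₁ hadd₂ hgal inv halt hPT' hH3 hfin (ι z) (ι t) =
      zmodToCircle (m * m) (ctGeneralFun W m e hμ hadd₁ hadd₂ hgal inv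
        (torsionH1ToH1 W ((m * m : ℕ) : ℤ) z) (torsionH1ToH1 W ((m * m : ℕ) : ℤ) t)) := by
  rw [ctLevelPairing_apply, hι, hι]

include hι in
/-- The pulled-back Cassels–Tate value is NONZERO iff the `ℤ/m²`-valued general-case pairing of the
images is nonzero (`zmodToCircle` is injective). [cite: MilneADT2006, Ch. I §6, Prop. 6.9] -/
theorem ctLevelPairing_pullback_ne_zero_iff [W.IsElliptic] (z t : selmerGroup W ((m * m : ℕ) : ℤ)) :
    ctLevelPairing W m e hμ hadd₁ hadd₂ hgal inv halt hPT' hH3 hfin (ι z) (ι t) ≠ 0 ↔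
      ctGeneralFun W m e hμ hadd₁ hadd₂ hgal inv
        (torsionH1ToH1 W ((m * m : ℕ) : ℤ) z) (torsionH1ToH1 W ((m * m : ℕ) : ℤ) t) ≠ 0 := by
  rw [ctLevelPairing_pullback_apply e hμ hadd₁ hadd₂ hgal inv halt hPT' hH3 hfin ι hι]
  exact not_congr ⟨fun h => zmodToCircle_injective _ (h.trans (map_zero _).symm),
    fun h => by rw [h, map_zero]⟩

end Level

end Literature.NumberTheory.EllipticCurves

end
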